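import Summits.CriticalPhenomena.PercolationContinuityZ3.Theorems.PercNearOneGluingNoHeavyLowerTailRefinedRowsSepDualRandomCluster
import Summits.CriticalPhenomena.PercolationContinuityZ3.Theorems.PercNearOneGluingNoHeavyLowerTailRefinedRowsSepDualCells
import Summits.CriticalPhenomena.PercolationContinuityZ3.Theorems.PercNearOneGluingNoHeavyLowerTailRefinedRowR2LatticeCondition
import Summits.CriticalPhenomena.PercolationContinuityZ3.Theorems.PercNearOneGluingNoHeavyLowerTailRefinedRowR1
import Summits.CriticalPhenomena.PercolationContinuityZ3.Theorems.PercNearOneGluingNoHeavyLowerTailRefinedRowR4PlusSwitching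
import Literature.Probability.Percolation.DecisionTreeWeightedMeasure
import HarnessLib

/-!
# `NoHeavyLowerTail` (stmt-CriticalPhenomena-4575) — the refined S-side rows as statements about MEASURES:
# R1, R3, R4⁺ for `prodBernoulli w`, and R3, R4⁺ for `φ_{𝐩,q}` (`q ≥ 1`) given R1, in the cells of `…RefinedRowR3Switching`

Support file (prover prim-gen-kcluster gen 50; `--supports stmt-CriticalPhenomena-4575`).  No named facts, no sorries, no definitions.

The kernel theorems R1 (`RefinedRowR1.r1_PrW` = `DualBHK.dualBHK`), R3 (`RefinedRowR3.r3_PrW`), R4⁺ (`RefinedRowR4.r4plus_PrW`) are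
stated for the finitary masses `PrW D p`; the S-side random-cluster results of this gen (`SepDual.r3_of_r1_rcMeasureW`,
`r4plus_of_r1_rcMeasureW`) are stated on the atoms of the separation events.  This file reads all of them on ONE family of events,
the refined cells evaluated on `ω.toFinset` (`{ω | ω.toFinset ∈ cellSa D a b c}`, …), for parameters `w` supported on the pair
set `D`:
* `rcMeasureW_real_congr_support` — events agreeing on the configurations inside the support have the same `φ^B_{𝐩,q}`-mass
  (configurations meeting a parameter-`0` pair weigh `0`, `RefinedRowR2.rcWeightW_eq_zero_of_mem`);
* `prodBernoulli_real_toFinset_eq_PrW` — `P_w{ω | ω.toFinset ∈ X} = PrW D w X` (the tree's cylinder bridge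
  `DecisionTree.prodBernoulli_real_eq_PrW` applied to the `D`-determined version `{ω | D.filter (· ∈ ω) ∈ X}`);
* **`r1_prodBernoulli`, `r3_prodBernoulli`, `r4plus_prodBernoulli`** — the three kernel rows as inequalities between
  `prodBernoulli w`-probabilities of the cell events (`q = 1`, unconditional);
* `real_cellT_eq_sepAtom`, … (eight conversions, from `SepDual.mem_cellT_iff_sep`, …) and
  **`r3_of_r1_rcMeasureW_cells`, `r4plus_of_r1_rcMeasureW_cells`** — for `φ = rcMeasureW w q ∅`, `q ≥ 1`:
  `φ(T)φ(S_a) ≤ φ(U_b)φ(U_c)` (and the same at `b`) ⟹ `φ(S_a)φ(S_b) ≤ φ(U_c)φ(B_0)`; `φ(T)φ(S_a) ≤ φ(U_b)φ(U_c)` ⟹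
  `φ(S_a)(φ(U_a)+φ(S_c)) ≤ φ(U_b)(φ(B_0)+φ(S_b))` — the q-deformation of R3/R4⁺ reduced to that of R1 (KCLUSTER-gen50).
Cells: `T = cellT a b c`, `S_x = cellS{x} D a b c`, `B_0 = cellB0 D a b c`, `U_c = cellUc a b c` (`ab|c`), `U_b = cellUc a c b`,
`U_a = cellUa a b c` (the tree's `r4plus_PrW` writes `U_a` as `cellUc b c a`, the same set).
-/

noncomputable section

namespace Summit.CriticalPhenomena.PercolationContinuityZ3.Theorems

namespace SepDual

open Finset Literature.Probability.Percolation Literature.Probability.Percolation.DecisionTree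
open Literature.Probability.Percolation.Gladkov ThreePointLB RefinedRowR3 RefinedRowR2
open MeasureTheory Literature.Probability.LatticeModels
open scoped Classical

variable {V : Type*} [Fintype V]

/-! ### Support congruence and the cylinder bridge -/

/-- **Support congruence for `φ^B_{𝐩,q}`**: if the parameters vanish off `E` and two events agree on the configurations inside
`E`, they have the same mass (configurations meeting `Eᶜ` weigh `0`). [this work] -/
theorem rcMeasureW_real_congr_support (w : Sym2 V → unitInterval) {q : ℝ} (hq : 0 < q) (B : Set V) (E : Set (Sym2 V))
    (hw : ∀ e, e ∉ E → w e = 0) {A A' : Set (BondConfig V)} (h : ∀ ω : BondConfig V, ω ⊆ E → (ω ∈ A ↔ ω ∈ A')) :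
    (rcMeasureW w q B).real A = (rcMeasureW w q B).real A' := by
  rw [rcMeasureW_real_apply w hq B A, rcMeasureW_real_apply w hq B A']
  refine Finset.sum_congr rfl fun ω _ => ?_
  by_cases hωE : ω ⊆ E
  · rw [show (ω ∈ A) = (ω ∈ A') from propext (h ω hωE)]
  · obtain ⟨e, heω, heE⟩ := Set.not_subset.1 hωE
    rw [rcWeightW_eq_zero_of_mem w q B heω (hw e heE), zero_div]
    split_ifs <;> rfl

/-- For a configuration inside the support, the support-filter is the configuration itself. [this work] -/
theorem filter_mem_eq_toFinset {D : Finset (Sym2 V)} {ω : BondConfig V} (hω : ω ⊆ (↑D : Set (Sym2 V))) :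
    D.filter (fun e => e ∈ ω) = ω.toFinset := by
  ext e
  simp only [Finset.mem_filter, Set.mem_toFinset]
  exact ⟨fun h => h.2, fun h => ⟨hω h, h⟩⟩

/-- **Cylinder bridge**: for parameters `w` supported on `D`, `P_w{ω | ω.toFinset ∈ X} = PrW D w X` for every family `X` of
finite configurations. [this work] -/
theorem prodBernoulli_real_toFinset_eq_PrW (D : Finset (Sym2 V)) (w : Sym2 V → unitInterval) (hw : ∀ e, e ∉ D → w e = 0)
    (X : Set (Finset (Sym2 V))) :
    (prodBernoulli w).real {ω : BondConfig V | ω.toFinset ∈ X} = PrW D (fun e => (w e : ℝ)) X := by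
  -- replace the event by its `D`-determined version
  have h1 : (prodBernoulli w).real {ω : BondConfig V | ω.toFinset ∈ X} =
      (prodBernoulli w).real {ω : BondConfig V | D.filter (fun e => e ∈ ω) ∈ X} := by
    rw [← rcMeasureW_one w ∅]
    refine rcMeasureW_real_congr_support w one_pos ∅ (↑D : Set (Sym2 V)) (fun e he => hw e (by exact_mod_cast he)) ?_
    intro ω hω
    simp only [Set.mem_setOf_eq]
    rw [filter_mem_eq_toFinset hω]
  rw [h1]
  refine prodBernoulli_real_eq_PrW w (D := D) ?_ ?_
  · rw [determinedBy_iff]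
    intro ω ω' hωω'
    have hf : D.filter (fun e => e ∈ ω) = D.filter (fun e => e ∈ ω') := by
      ext e
      simp only [Finset.mem_filter]
      constructor
      · rintro ⟨heD, heω⟩
        have : e ∈ ω' ∩ (↑D : Set (Sym2 V)) := by rw [← hωω']; exact ⟨heω, by exact_mod_cast heD⟩
        exact ⟨heD, this.1⟩
      · rintro ⟨heD, heω⟩
        have : e ∈ ω ∩ (↑D : Set (Sym2 V)) := by rw [hωω']; exact ⟨heω, by exact_mod_cast heD⟩
        exact ⟨heD, this.1⟩
    simp only [Set.mem_setOf_eq]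
    rw [hf]
  · intro S hS
    simp only [Set.mem_setOf_eq, Finset.mem_coe]
    have hf : D.filter (fun e => e ∈ S) = S := by
      ext e
      simp only [Finset.mem_filter]
      exact ⟨fun h => h.2, fun h => ⟨hS h, h⟩⟩
    rw [hf]

/-! ### R1, R3, R4⁺ for the product measure (q = 1, unconditional) -/

section ProductMeasure

variable (D : Finset (Sym2 V)) (w : Sym2 V → unitInterval) (hw : ∀ e, e ∉ D → w e = 0) (a b c : V)
include hw

/-- **R1 for `prodBernoulli w`** (`t·s_a ≤ u_b·u_c`; dual BHK, `RefinedRowR1.r1_PrW` = `DualBHK.dualBHK`), parameters supported on `D`: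
`P(T)·P(S_a) ≤ P(U_c)·P(U_b)`. [this work; = `DualBHK.dualBHK`] -/
theorem r1_prodBernoulli :
    (prodBernoulli w).real {ω : BondConfig V | ω.toFinset ∈ cellT a b c} *
        (prodBernoulli w).real {ω : BondConfig V | ω.toFinset ∈ cellSa D a b c} ≤
      (prodBernoulli w).real {ω : BondConfig V | ω.toFinset ∈ cellUc a b c} *
        (prodBernoulli w).real {ω : BondConfig V | ω.toFinset ∈ cellUc a c b} := by
  simp only [prodBernoulli_real_toFinset_eq_PrW D w hw]
  exact RefinedRowR1.r1_PrW D (fun e => (w e).2.1) (fun e => (w e).2.2) a b c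

variable {a b c}

/-- **R3 for `prodBernoulli w`** (`s_a·s_b ≤ u_c·b₀`; `RefinedRowR3.r3_PrW`), parameters supported on a `D` joining the terminals:
`P(S_a)·P(S_b) ≤ P(U_c)·P(B_0)`. [this work; = `RefinedRowR3.r3_PrW`] -/
theorem r3_prodBernoulli (hDb : b ∈ cl D a) (hDc : c ∈ cl D a) :
    (prodBernoulli w).real {ω : BondConfig V | ω.toFinset ∈ cellSa D a b c} *
        (prodBernoulli w).real {ω : BondConfig V | ω.toFinset ∈ cellSb D a b c} ≤
      (prodBernoulli w).real {ω : BondConfig V | ω.toFinset ∈ cellUc a b c} *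
        (prodBernoulli w).real {ω : BondConfig V | ω.toFinset ∈ cellB0 D a b c} := by
  simp only [prodBernoulli_real_toFinset_eq_PrW D w hw]
  exact RefinedRowR3.r3_PrW D (fun e => (w e).2.1) (fun e => (w e).2.2) a b c hDb hDc

/-- **R4⁺ for `prodBernoulli w`** (`s_a(u_a+s_c) ≤ u_b(b₀+s_b)`; `RefinedRowR4.r4plus_PrW`), parameters supported on a `D`
joining the terminals. [this work; = `RefinedRowR4.r4plus_PrW`] -/
theorem r4plus_prodBernoulli (hDb : b ∈ cl D a) (hDc : c ∈ cl D a) :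
    (prodBernoulli w).real {ω : BondConfig V | ω.toFinset ∈ cellSa D a b c} *
        ((prodBernoulli w).real {ω : BondConfig V | ω.toFinset ∈ cellUc b c a} +
          (prodBernoulli w).real {ω : BondConfig V | ω.toFinset ∈ cellSc D a b c}) ≤
      (prodBernoulli w).real {ω : BondConfig V | ω.toFinset ∈ cellUc a c b} *
        ((prodBernoulli w).real {ω : BondConfig V | ω.toFinset ∈ cellB0 D a b c} +
          (prodBernoulli w).real {ω : BondConfig V | ω.toFinset ∈ cellSb D a b c}) := by
  simp only [prodBernoulli_real_toFinset_eq_PrW D w hw]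
  exact RefinedRowR4.r4plus_PrW D (fun e => (w e).2.1) (fun e => (w e).2.2) a b c hDb hDc

end ProductMeasure

/-! ### The cells as separation atoms, in `φ^B_{𝐩,q}`-mass -/

section Conversions

/-- Inside the support, `ω.toFinset ⊆ D`. [this work] -/
private theorem toFinset_sub (D : Finset (Sym2 V)) {ω : BondConfig V} (hω : ω ⊆ (↑D : Set (Sym2 V))) :
    ω.toFinset ⊆ D :=
  Set.toFinset_subset.2 hω

variable [DecidableEq V] (D : Finset (Sym2 V)) (w : Sym2 V → unitInterval) (hw : ∀ e, e ∉ D → w e = 0)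
  {q : ℝ} (hq : 0 < q) (B : Set V) {a b c : V}
include hw hq

/-- `φ(T) = φ(Sep_a ∧ Sep_b ∧ Sep_c)`. [this work] -/
theorem real_cellT_eq_sepAtom (hab : a ≠ b) (hac : a ≠ c) (hbc : b ≠ c) (hDc : c ∈ cl D a) :
    (rcMeasureW w q B).real {ω : BondConfig V | ω.toFinset ∈ cellT a b c} =
      (rcMeasureW w q B).real {ω : BondConfig V | Sep D (cl ω.toFinset a) b c ∧
        Sep D (cl ω.toFinset b) a c ∧ Sep D (cl ω.toFinset c) a b} :=
  rcMeasureW_real_congr_support w hq B (↑D) (fun e he => hw e (by exact_mod_cast he)) fun _ hω =>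
    mem_cellT_iff_sep (toFinset_sub D hω) hab hac hbc hDc

/-- `φ(S_a) = φ(Sep_a ∧ ¬Sep_b ∧ ¬Sep_c)`. [this work] -/
theorem real_cellSa_eq_sepAtom (hab : a ≠ b) (hac : a ≠ c) (hDb : b ∈ cl D a) (hDc : c ∈ cl D a) :
    (rcMeasureW w q B).real {ω : BondConfig V | ω.toFinset ∈ cellSa D a b c} =
      (rcMeasureW w q B).real {ω : BondConfig V | Sep D (cl ω.toFinset a) b c ∧
        ¬ Sep D (cl ω.toFinset b) a c ∧ ¬ Sep D (cl ω.toFinset c) a b} :=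
  rcMeasureW_real_congr_support w hq B (↑D) (fun e he => hw e (by exact_mod_cast he)) fun _ hω =>
    mem_cellSa_iff_sep (toFinset_sub D hω) hab hac hDb hDc

/-- `φ(S_b) = φ(¬Sep_a ∧ Sep_b ∧ ¬Sep_c)`. [this work] -/
theorem real_cellSb_eq_sepAtom (hab : a ≠ b) (hbc : b ≠ c) (hDb : b ∈ cl D a) (hDc : c ∈ cl D a) :
    (rcMeasureW w q B).real {ω : BondConfig V | ω.toFinset ∈ cellSb D a b c} =
      (rcMeasureW w q B).real {ω : BondConfig V | ¬ Sep D (cl ω.toFinset a) b c ∧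
        Sep D (cl ω.toFinset b) a c ∧ ¬ Sep D (cl ω.toFinset c) a b} :=
  rcMeasureW_real_congr_support w hq B (↑D) (fun e he => hw e (by exact_mod_cast he)) fun _ hω =>
    mem_cellSb_iff_sep (toFinset_sub D hω) hab hbc hDb hDc

/-- `φ(S_c) = φ(¬Sep_a ∧ ¬Sep_b ∧ Sep_c)`. [this work] -/
theorem real_cellSc_eq_sepAtom (hac : a ≠ c) (hbc : b ≠ c) (hDb : b ∈ cl D a) :
    (rcMeasureW w q B).real {ω : BondConfig V | ω.toFinset ∈ cellSc D a b c} =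
      (rcMeasureW w q B).real {ω : BondConfig V | ¬ Sep D (cl ω.toFinset a) b c ∧
        ¬ Sep D (cl ω.toFinset b) a c ∧ Sep D (cl ω.toFinset c) a b} :=
  rcMeasureW_real_congr_support w hq B (↑D) (fun e he => hw e (by exact_mod_cast he)) fun _ hω =>
    mem_cellSc_iff_sep (toFinset_sub D hω) hac hbc hDb

/-- `φ(B_0) = φ(¬Sep_a ∧ ¬Sep_b ∧ ¬Sep_c)`. [this work] -/
theorem real_cellB0_eq_sepAtom (hac : a ≠ c) (hbc : b ≠ c) :
    (rcMeasureW w q B).real {ω : BondConfig V | ω.toFinset ∈ cellB0 D a b c} =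
      (rcMeasureW w q B).real {ω : BondConfig V | ¬ Sep D (cl ω.toFinset a) b c ∧
        ¬ Sep D (cl ω.toFinset b) a c ∧ ¬ Sep D (cl ω.toFinset c) a b} :=
  rcMeasureW_real_congr_support w hq B (↑D) (fun e he => hw e (by exact_mod_cast he)) fun _ _ =>
    mem_cellB0_iff_sep hac hbc

/-- `φ(U_c) = φ(Sep_a ∧ Sep_b ∧ ¬Sep_c)`. [this work] -/
theorem real_cellUc_eq_sepAtom (hab : a ≠ b) (hac : a ≠ c) (hbc : b ≠ c) (hDc : c ∈ cl D a) :
    (rcMeasureW w q B).real {ω : BondConfig V | ω.toFinset ∈ cellUc a b c} =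
      (rcMeasureW w q B).real {ω : BondConfig V | Sep D (cl ω.toFinset a) b c ∧
        Sep D (cl ω.toFinset b) a c ∧ ¬ Sep D (cl ω.toFinset c) a b} :=
  rcMeasureW_real_congr_support w hq B (↑D) (fun e he => hw e (by exact_mod_cast he)) fun _ hω =>
    mem_cellUc_iff_sep (toFinset_sub D hω) hab hac hbc hDc

/-- `φ(U_b) = φ(Sep_a ∧ ¬Sep_b ∧ Sep_c)`. [this work] -/
theorem real_cellUb_eq_sepAtom (hab : a ≠ b) (hac : a ≠ c) (hbc : b ≠ c) (hDb : b ∈ cl D a) :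
    (rcMeasureW w q B).real {ω : BondConfig V | ω.toFinset ∈ cellUc a c b} =
      (rcMeasureW w q B).real {ω : BondConfig V | Sep D (cl ω.toFinset a) b c ∧
        ¬ Sep D (cl ω.toFinset b) a c ∧ Sep D (cl ω.toFinset c) a b} :=
  rcMeasureW_real_congr_support w hq B (↑D) (fun e he => hw e (by exact_mod_cast he)) fun _ hω =>
    mem_cellUb_iff_sep (toFinset_sub D hω) hab hac hbc hDb

/-- `φ(U_a) = φ(¬Sep_a ∧ Sep_b ∧ Sep_c)`. [this work] -/
theorem real_cellUa_eq_sepAtom (hab : a ≠ b) (hac : a ≠ c) (hbc : b ≠ c) (hDb : b ∈ cl D a) :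
    (rcMeasureW w q B).real {ω : BondConfig V | ω.toFinset ∈ cellUa a b c} =
      (rcMeasureW w q B).real {ω : BondConfig V | ¬ Sep D (cl ω.toFinset a) b c ∧
        Sep D (cl ω.toFinset b) a c ∧ Sep D (cl ω.toFinset c) a b} :=
  rcMeasureW_real_congr_support w hq B (↑D) (fun e he => hw e (by exact_mod_cast he)) fun _ hω =>
    mem_cellUa_iff_sep (toFinset_sub D hω) hab hac hbc hDb

end Conversions

/-! ### R3 and R4⁺ for `φ_{𝐩,q}`, `q ≥ 1`, given R1 — in the cells -/

section RandomClusterCells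

variable [DecidableEq V] (D : Finset (Sym2 V)) (w : Sym2 V → unitInterval) (hw : ∀ e, e ∉ D → w e = 0)
  {q : ℝ} (hq : 1 ≤ q) {a b c : V} (hab : a ≠ b) (hac : a ≠ c) (hbc : b ≠ c) (hDb : b ∈ cl D a) (hDc : c ∈ cl D a)
include hw hq hab hac hbc hDb hDc

/-- **R3 ⟸ R1 for `φ_{𝐩,q}`, `q ≥ 1`, in the refined cells** (parameters supported on `D` joining the distinct terminals):
R1 at `a` (`φ(T)φ(S_a) ≤ φ(U_b)φ(U_c)`) and at `b` (`φ(T)φ(S_b) ≤ φ(U_a)φ(U_c)`) give R3 `φ(S_a)φ(S_b) ≤ φ(U_c)φ(B_0)`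
(`SepDual.r3_of_r1_rcMeasureW` read through the conversions). [this work] -/
theorem r3_of_r1_rcMeasureW_cells
    (hR1a : (rcMeasureW w q ∅).real {ω : BondConfig V | ω.toFinset ∈ cellT a b c} *
        (rcMeasureW w q ∅).real {ω : BondConfig V | ω.toFinset ∈ cellSa D a b c} ≤
      (rcMeasureW w q ∅).real {ω : BondConfig V | ω.toFinset ∈ cellUc a c b} *
        (rcMeasureW w q ∅).real {ω : BondConfig V | ω.toFinset ∈ cellUc a b c})
    (hR1b : (rcMeasureW w q ∅).real {ω : BondConfig V | ω.toFinset ∈ cellT a b c} *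
        (rcMeasureW w q ∅).real {ω : BondConfig V | ω.toFinset ∈ cellSb D a b c} ≤
      (rcMeasureW w q ∅).real {ω : BondConfig V | ω.toFinset ∈ cellUa a b c} *
        (rcMeasureW w q ∅).real {ω : BondConfig V | ω.toFinset ∈ cellUc a b c}) :
    (rcMeasureW w q ∅).real {ω : BondConfig V | ω.toFinset ∈ cellSa D a b c} *
        (rcMeasureW w q ∅).real {ω : BondConfig V | ω.toFinset ∈ cellSb D a b c} ≤
      (rcMeasureW w q ∅).real {ω : BondConfig V | ω.toFinset ∈ cellUc a b c} *
        (rcMeasureW w q ∅).real {ω : BondConfig V | ω.toFinset ∈ cellB0 D a b c} := by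
  have hq0 : 0 < q := one_pos.trans_le hq
  rw [real_cellT_eq_sepAtom D w hw hq0 ∅ hab hac hbc hDc, real_cellSa_eq_sepAtom D w hw hq0 ∅ hab hac hDb hDc,
    real_cellUb_eq_sepAtom D w hw hq0 ∅ hab hac hbc hDb, real_cellUc_eq_sepAtom D w hw hq0 ∅ hab hac hbc hDc] at hR1a
  rw [real_cellT_eq_sepAtom D w hw hq0 ∅ hab hac hbc hDc, real_cellSb_eq_sepAtom D w hw hq0 ∅ hab hbc hDb hDc,
    real_cellUa_eq_sepAtom D w hw hq0 ∅ hab hac hbc hDb, real_cellUc_eq_sepAtom D w hw hq0 ∅ hab hac hbc hDc] at hR1b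
  rw [real_cellSa_eq_sepAtom D w hw hq0 ∅ hab hac hDb hDc, real_cellSb_eq_sepAtom D w hw hq0 ∅ hab hbc hDb hDc,
    real_cellUc_eq_sepAtom D w hw hq0 ∅ hab hac hbc hDc, real_cellB0_eq_sepAtom D w hw hq0 ∅ hac hbc]
  exact r3_of_r1_rcMeasureW D w hq a b c hR1a hR1b

/-- **R4⁺ ⟸ R1 for `φ_{𝐩,q}`, `q ≥ 1`, in the refined cells**: R1 at `a` gives
`φ(S_a)·(φ(U_a) + φ(S_c)) ≤ φ(U_b)·(φ(B_0) + φ(S_b))` (`SepDual.r4plus_of_r1_rcMeasureW` read through the conversions).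
[this work] -/
theorem r4plus_of_r1_rcMeasureW_cells
    (hR1a : (rcMeasureW w q ∅).real {ω : BondConfig V | ω.toFinset ∈ cellT a b c} *
        (rcMeasureW w q ∅).real {ω : BondConfig V | ω.toFinset ∈ cellSa D a b c} ≤
      (rcMeasureW w q ∅).real {ω : BondConfig V | ω.toFinset ∈ cellUc a c b} *
        (rcMeasureW w q ∅).real {ω : BondConfig V | ω.toFinset ∈ cellUc a b c}) :
    (rcMeasureW w q ∅).real {ω : BondConfig V | ω.toFinset ∈ cellSa D a b c} *
        ((rcMeasureW w q ∅).real {ω : BondConfig V | ω.toFinset ∈ cellUa a b c} +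
          (rcMeasureW w q ∅).real {ω : BondConfig V | ω.toFinset ∈ cellSc D a b c}) ≤
      (rcMeasureW w q ∅).real {ω : BondConfig V | ω.toFinset ∈ cellUc a c b} *
        ((rcMeasureW w q ∅).real {ω : BondConfig V | ω.toFinset ∈ cellB0 D a b c} +
          (rcMeasureW w q ∅).real {ω : BondConfig V | ω.toFinset ∈ cellSb D a b c}) := by
  have hq0 : 0 < q := one_pos.trans_le hq
  rw [real_cellT_eq_sepAtom D w hw hq0 ∅ hab hac hbc hDc, real_cellSa_eq_sepAtom D w hw hq0 ∅ hab hac hDb hDc,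
    real_cellUb_eq_sepAtom D w hw hq0 ∅ hab hac hbc hDb, real_cellUc_eq_sepAtom D w hw hq0 ∅ hab hac hbc hDc] at hR1a
  rw [real_cellSa_eq_sepAtom D w hw hq0 ∅ hab hac hDb hDc, real_cellUa_eq_sepAtom D w hw hq0 ∅ hab hac hbc hDb,
    real_cellSc_eq_sepAtom D w hw hq0 ∅ hac hbc hDb, real_cellUb_eq_sepAtom D w hw hq0 ∅ hab hac hbc hDb,
    real_cellB0_eq_sepAtom D w hw hq0 ∅ hac hbc, real_cellSb_eq_sepAtom D w hw hq0 ∅ hab hbc hDb hDc]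
  exact r4plus_of_r1_rcMeasureW D w hq a b c hR1a

end RandomClusterCells

end SepDual

end Summit.CriticalPhenomena.PercolationContinuityZ3.Theorems

end
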